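import Summits.HodgeConjecture.HodgeConjecture.Theses.EndoscopicMiddleDegree

/-!
# `SectorComplement`: what a refutation would have to contain (negative-side lemmas)

Refuter lane `Theorems/SectorComplement/Negative/` for the crux
`EndoscopicMiddleDegree.SectorComplement := MiddleDegreeStep → HodgeConjecture`
(stmt-HodgeConjecture-14353, sector frame of route `EndoscopicMiddleDegree`). No Theses decl is
asserted; every statement below is a negation or an equivalence.

* `not_sectorComplement_iff`: `¬ SectorComplement ↔ MiddleDegreeStep ∧ ¬ HodgeConjecture` — a
  refutation must PROVE the route target (HC in the middle degree of compact arithmetic 4- and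
  6-ball quotients) AND refute the formal summit. The non-trivial direction uses that the target is
  a corollary of the summit (the datum's field `UnitaryBallQuotientDatum.isSmoothProjective` feeds
  the second conjunct of `HodgeConjectureFor (2(m+1)) X` at `p := m + 1`).
* `not_hodgeConjecture_of_not_sectorComplement`, `not_hodgeConjecture_of_not_middleDegreeStep`:
  any kill of the frame, or of the target, is a disproof of `_root_.HodgeConjecture`.
* `sectorComplement_iff_not_middleDegreeStep_or`: `SectorComplement ↔ ¬ MiddleDegreeStep ∨ HC` —
  the frame is false in exactly one world: HC fails, but only off the sector.
* `hodgeConjecture_iff_middleDegreeStep_and_sectorComplement`: `HC ↔ target ∧ frame` — the frame is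
  precisely "HC minus the sector" (declared, not claimed; D-0027 §2.1).
-/

set_option linter.dupNamespace false

namespace Summit.HodgeConjecture.HodgeConjecture.Theorems.SectorComplement.Negative

open Summit.HodgeConjecture.HodgeConjecture.Theses.EndoscopicMiddleDegree

/-- The exact content of a refutation of the frame: `¬ SectorComplement ↔ MiddleDegreeStep ∧ ¬ HC`.
(`←` is propositional; `→` uses that HC implies the target through the datum's
`isSmoothProjective` field.) [folklore] -/
theorem not_sectorComplement_iff :
    ¬ SectorComplement ↔ MiddleDegreeStep ∧ ¬ _root_.HodgeConjecture := by
  constructor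
  · intro h
    have hHC : ¬ _root_.HodgeConjecture := fun hHC ↦ h fun _ ↦ hHC
    refine ⟨?_, hHC⟩
    by_contra hM
    exact h fun hM' ↦ absurd hM' hM
  · rintro ⟨hM, hHC⟩ hS
    exact hHC (hS hM)

/-- Any refutation of the frame refutes the formal summit `_root_.HodgeConjecture`. [folklore] -/
theorem not_hodgeConjecture_of_not_sectorComplement (h : ¬ SectorComplement) :
    ¬ _root_.HodgeConjecture :=
  (not_sectorComplement_iff.1 h).2

/-- Any refutation of the route TARGET refutes the formal summit: a ball-quotient datum records
`IsSmoothProjective (2(m+1)) X`, and conjunct 2 of `HodgeConjectureFor (2(m+1)) X` at `p := m + 1`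
is the target's conclusion. [folklore] -/
theorem not_hodgeConjecture_of_not_middleDegreeStep (h : ¬ MiddleDegreeStep) :
    ¬ _root_.HodgeConjecture := by
  intro hHC
  refine h fun m X _ _ hD _ c hc hH ↦ ?_
  obtain ⟨D⟩ := hD
  exact (hHC D.isSmoothProjective).2 (m + 1) c hc hH

/-- Truth table of the frame: `SectorComplement ↔ ¬ MiddleDegreeStep ∨ HC`. It is PROVABLE only by
proving HC or by refuting HC on the sector (a non-algebraic rational middle-degree class on a compact
arithmetic 4- or 6-ball quotient), and REFUTABLE only in the world "HC false, every counterexample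
off the sector". [folklore] -/
theorem sectorComplement_iff_not_middleDegreeStep_or :
    SectorComplement ↔ ¬ MiddleDegreeStep ∨ _root_.HodgeConjecture := by
  constructor
  · intro h
    by_cases hM : MiddleDegreeStep
    · exact Or.inr (h hM)
    · exact Or.inl hM
  · rintro (hM | hHC) hM'
    · exact absurd hM' hM
    · exact hHC

/-- Bookkeeping identity: `HC ↔ MiddleDegreeStep ∧ SectorComplement` — the frame is exactly
"HC minus the sector". [folklore] -/
theorem hodgeConjecture_iff_middleDegreeStep_and_sectorComplement :
    _root_.HodgeConjecture ↔ MiddleDegreeStep ∧ SectorComplement := by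
  constructor
  · intro hHC
    refine ⟨?_, fun _ ↦ hHC⟩
    by_contra hM
    exact not_hodgeConjecture_of_not_middleDegreeStep hM hHC
  · exact fun h ↦ h.2 h.1

end Summit.HodgeConjecture.HodgeConjecture.Theorems.SectorComplement.Negative
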